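import Summits.NavierStokesRegularity.NavierStokesRegularity.Theorems.TypeILiouvilleTypeIliouvilleNoTypeIIEternalEnergyLiouvilleLimitSetStrata
import HarnessLib

/-!
# EEL′ reduces to its core: extremal, unsteady, aperiodic, swirling-or-asymmetric, non-self-similar
# profiles (crux `TypeIliouvilleNoTypeII`, stmt-NavierStokesRegularity-0056; rigidity residual EEL′
# of the pressure-free eternal split)

Helper file (theorems only) — the CAPSTONE of this seat's EEL′ strata (p459618 steady, p472380
periodic, p472579 sup-attained, p473585 axisymmetric-no-swirl, p482983 DSS).  The pressure-free
eternal energy Liouville statement EEL′ (the `hEEL` binder of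
`EternalSplit.typeIliouvilleNoTypeII_of_pressureFreeSlab_of_eternalLiouville`, p456438; under it
`S₁_unit ↔ NoTypeII`, p464213) follows from its restriction to the CORE of the class:

  **EEL′_core**: every bounded eternal Oseen-mild smooth divergence-free `W` with `A_ess, C, E ≤ I < ∞`
  on all parabolic balls which
  (i)   is EXTREMAL — `‖W(s, y)‖ ≤ ‖W(0, 0)‖` for all `(s, y)`,
  (ii)  is NOT time-independent,
  (iii) is NOT time-periodic,
  (iv)  is NOT axisymmetric-without-swirl about the `x₃`-axis,
  (v)   is NOT discretely self-similar about the origin,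
  has `W(0, 0) = 0`.

* `eternalLiouvillePressureFree_of_core` — **EEL′ ⟸ EEL′_core**, both in the exact `hEEL` shape
  (proof: the sup-attained reduction, then on each excluded stratum the field vanishes identically by
  the stratum theorems `eq_zero_of_timeIndependent`, `periodic_eq_zero_of_cknAEss_le_of_cknE_le`,
  `eternal_eq_zero_of_axisymNoSwirl_of_cknAEss_le`, `eq_zero_of_dss`).

A typed residual for the planners: the open content of EEL′ (hence, modulo S₁′, of the hard core
`NoTypeII`) is a Liouville theorem for TRANSIENT, genuinely three-dimensional, non-self-similar
extremal eternal profiles in the energy class.  WHAT THIS IS NOT: not NS; EEL′_core is OPEN.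
[folklore]
-/

noncomputable section

-- the summit and its single problem share the name `NavierStokesRegularity` (D-0017 nested layout)
set_option linter.dupNamespace false

open Set Function Filter Topology MeasureTheory Metric
open scoped NNReal ENNReal

namespace Summit.NavierStokesRegularity.NavierStokesRegularity.Theorems.TypeIliouvilleNoTypeII.TypeIIZoom

open Literature.Analysis Literature.Analysis.FluidPDE

/-- **EEL′ follows from EEL′ on the core.**  Suppose every jointly smooth, divergence-free, eternal
Oseen-mild field `W` on `ℝ × ℝ³` with `A_ess, C, E ≤ I` (`I ≠ ∞`) on all parabolic balls which is
extremal (`‖W‖ ≤ ‖W(0,0)‖`), not time-independent, not time-periodic, not axisymmetric-without-swirl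
and not discretely self-similar has `W(0, 0) = 0`.  Then EEL′ holds: every such field with
`‖v‖ ≤ 2` has `v(0, 0) = 0`. [cite: KochNadirashviliSereginSverak2009, Lemma 6.1, Prop. 4.1 and Thm 5.2 (arXiv:0709.3599 pp. 8–11)] -/
theorem eternalLiouvillePressureFree_of_core
    (hcore : ∀ W : ℝ → EuclideanSpace ℝ (Fin 3) → EuclideanSpace ℝ (Fin 3),
      ContDiff ℝ (⊤ : ℕ∞) (uncurry W) → (∀ t, VectorCalculus.IsDivFree (W t)) →
      (∀ s t : ℝ, s < t → ∀ x, W t x = heatFlow (W s) (t - s) x - oseenDuhamel 1 s W W t x) →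
      (∀ t x, ‖W t x‖ ≤ ‖W 0 0‖) →
      (∃ I : ℝ≥0∞, I ≠ ⊤ ∧ ∀ r : ℝ, 0 < r → ∀ z : ℝ × EuclideanSpace ℝ (Fin 3),
        cknAEss r z W ≤ I ∧ cknC r z W ≤ I ∧ cknE r z (fun s y => fderiv ℝ (W s) y) ≤ I) →
      ¬ (∀ (t : ℝ) (y : EuclideanSpace ℝ (Fin 3)), W t y = W 0 y) →
      ¬ (∃ P : ℝ, 0 < P ∧ ∀ (t : ℝ) (x : EuclideanSpace ℝ (Fin 3)), W (t + P) x = W t x) →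
      ¬ ((∀ t, IsAxisymmetric (W t)) ∧ ∀ t, HasNoSwirl (W t)) →
      ¬ (∃ μ : ℝ, 1 < μ ∧ ∀ (s : ℝ) (y : EuclideanSpace ℝ (Fin 3)), W s y = μ • W (μ ^ 2 * s) (μ • y)) →
      W 0 0 = 0)
    (v : ℝ → EuclideanSpace ℝ (Fin 3) → EuclideanSpace ℝ (Fin 3))
    (hv : ContDiff ℝ (⊤ : ℕ∞) (uncurry v)) (hdiv : ∀ t, VectorCalculus.IsDivFree (v t))
    (hmild : ∀ s t : ℝ, s < t → ∀ x, v t x = heatFlow (v s) (t - s) x - oseenDuhamel 1 s v v t x)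
    (hbd : ∀ (t : ℝ) (x : EuclideanSpace ℝ (Fin 3)), ‖v t x‖ ≤ 2)
    (hI : ∃ I : ℝ≥0∞, I ≠ ⊤ ∧ ∀ r : ℝ, 0 < r → ∀ z : ℝ × EuclideanSpace ℝ (Fin 3),
      cknAEss r z v ≤ I ∧ cknC r z v ≤ I ∧ cknE r z (fun s y => fderiv ℝ (v s) y) ≤ I) :
    v 0 0 = 0 := by
  refine eternalLiouvillePressureFree_of_supAttained ?_ v hv hdiv hmild hbd hI
  intro W hW hWdiv hWmild hWsup hWI
  obtain ⟨I, hItop, hball⟩ := hWI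
  have hA : ∀ r : ℝ, 0 < r → ∀ z : ℝ × EuclideanSpace ℝ (Fin 3), cknAEss r z W ≤ I :=
    fun r hr z => (hball r hr z).1
  have hE : ∀ r : ℝ, 0 < r → ∀ z : ℝ × EuclideanSpace ℝ (Fin 3),
      cknE r z (fun s y => fderiv ℝ (W s) y) ≤ I := fun r hr z => (hball r hr z).2.2
  -- the four settled strata
  by_cases hsteady : ∀ (t : ℝ) (y : EuclideanSpace ℝ (Fin 3)), W t y = W 0 y
  · exact eq_zero_of_timeIndependent hW hsteady hItop hA hE 0 0
  by_cases hper : ∃ P : ℝ, 0 < P ∧ ∀ (t : ℝ) (x : EuclideanSpace ℝ (Fin 3)), W (t + P) x = W t x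
  · exact periodic_eq_zero_of_cknAEss_le_of_cknE_le hW hper
      ⟨I, hItop, fun r hr z => ⟨hA r hr z, hE r hr z⟩⟩ 0 0
  by_cases haxi : (∀ t, IsAxisymmetric (W t)) ∧ ∀ t, HasNoSwirl (W t)
  · exact eternal_eq_zero_of_axisymNoSwirl_of_cknAEss_le hW hWdiv hWmild ⟨‖W 0 0‖, hWsup⟩ haxi.1
      haxi.2 hItop hA 0 0
  by_cases hdss : ∃ μ : ℝ, 1 < μ ∧
      ∀ (s : ℝ) (y : EuclideanSpace ℝ (Fin 3)), W s y = μ • W (μ ^ 2 * s) (μ • y)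
  · obtain ⟨μ, hμ, hμW⟩ := hdss
    exact eq_zero_of_dss hWsup hμ hμW 0 0
  -- the core
  exact hcore W hW hWdiv hWmild hWsup ⟨I, hItop, hball⟩ hsteady hper haxi hdss

end Summit.NavierStokesRegularity.NavierStokesRegularity.Theorems.TypeIliouvilleNoTypeII.TypeIIZoom

end
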